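import Summits.CriticalPhenomena.PercolationContinuityZ3.Theses.PercBurnResprinkle
import Literature.Probability.Percolation.FiniteClustersPercolationOneArm
import Literature.Probability.Percolation.CriticalContinuityProofs
import Literature.Probability.Percolation.EnhancementAGLine

/-!
# Line `ag-dimensional-lift` — skeleton for the crux `VacantSetPercolates` (item stmt-CriticalPhenomena-7205)

Strategist: planner-cstrat-stmt-CriticalPhenomena-7205-p1-0 (wall-breaker pass, 2026-08-17).

Crux (route `PercBurnResprinkle`): `∃ p ∈ (p_c(ℤ³), 1], P_p(0 lies in an infinite component of X = ℤ³[{y : C(y) finite}]) > 0`,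
i.e. `p_c(ℤ³) < p_fin(3)` (Grimmett–Holroyd–Kozma 2014, open for `d = 3`).

IDEA (transfer of the solved sibling's step `p_c(ℤ³) < p_c(ℤ²)`, Aizenman–Grimmett 1991, to GHK's quiet proxy).
Write `Q_R(ω) = quietSet R ω` (sites with no open arm to sup-distance `R` inside their `R`-box; a quiet site has a
finite cluster, so lattice paths of quiet sites are paths of `X`).  Let `σ₂(R)` be the threshold in `p` of
nearest-neighbour percolation of the PLANAR SECTION `Q_R ∩ {x₂ = 0}` inside the plane, and `σ₃(R)` the threshold of
nearest-neighbour percolation of `Q_R` in `ℤ³` (both models are DECREASING in `p`; `σ₂ ≤ σ₃` trivially).  Then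

  `[ANCHOR]  ∃ R₀, σ₂(R₀) ≥ p_c(ℤ³)`   and   `[LIFT]  ∀ R, σ₂(R) < σ₃(R)`   give   `σ₃(R₀) > p_c(ℤ³)`,

hence the 3-D quiet proxy — a subset of the vacant set — percolates at some `p > p_c(ℤ³)`: the crux.

* `stub_planarAnchor` (OPEN; the hardest stub; anti-jump by necessity — Wall C of the crux notes): for some quietness
  scale `R₀` the planar `R₀`-quiet section percolates at EVERY `p < p_c(ℤ³)` ("the planar quiet section is not
  planar-subcritical at `p_c(ℤ³)`").  This is the WEAKEST member of the planar input class of the dead lines: it is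
  implied by line 1's `H = stub_planarQuietHalfScale` (planar SUPERcriticality at `p_c`) and by line 2's
  `stub_planarNonDegeneracy`/(a') (non-degeneracy AT `p_c`, via OSSS/DRT sharpness of the proxy in `p`), and it allows
  the boundary case `σ₂(R₀) = p_c(ℤ³)` (planar section exactly critical), which kills line 1.  Numerically true for
  `R₀ ≥ 8` (kit j006148/j012544: planar quiet crossings `0.93 → 1.00`; planar vacant section percolates up to `p ≈ 0.26`).
* `stub_dimensionalLift` (NEW, world-agnostic, tooled): strict dimensional enhancement `σ₃(R) > σ₂(R)` for every `R ≥ 1`,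
  in the pointwise form "`∃ δ > 0`: planar `R`-quiet percolation at `p` ⇒ spatial `R`-quiet percolation at every
  `q < p + δ`".  Engine IN TREE: `Literature.Probability.Percolation.AGLine.theta_line_mono` (abstract Aizenman–Grimmett /
  Martineau–Severo §6 line argument: two-parameter Russo + local-modification hypothesis `AGLine.LocMod`), run for the
  increasing-in-(closed bonds, marks) event "`0` is joined to `∂Λ_L` by planar quiet sites and MARKED ARCHES" (an arch =
  the three sites above a planar site, usable when the middle planar site carries a Bernoulli(`s`) mark and the arch sites
  are quiet; `s = 0` is the planar model, every `s`-model path is a 3-D quiet path).  The model-specific work is the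
  `LocMod` surgery (bond-pivotal ⇒ mark-pivotal by a bounded modification that only REMOVES marks): armed "posts" below the
  plane, an induced (geodesic) witness as corridor, one arch over a one-site armed wall; the delicate point is rim control
  (closing bonds can CREATE quiet sites within distance `R+1`).  This replaces line 2's tool-less 3-D local uniqueness at
  `p_c` (stub (b)) and line 1's "→ 1" requirement: NON-DEGENERACY OF THE PLANAR SECTION SUFFICES.
* Composition `VacantSetPercolates_of` (proved below, no sorry): pick `p = max(p_c - δ/2, 0) < p_c` (anchor applies),
  `q = min(p_c + δ/4, (p_c+1)/2) ∈ (p_c, p + δ) ∩ [0,1]` (lift applies), and lift a 3-D quiet path to GHK's graph `X`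
  (`reachable_finiteClusters_of_pathIn`, a.s. `ω ⊆ E(ℤ³)`).

DISPROOF USED (`Cruxes/VacantSetPercolates/Disproof.lean`, cycles 1–2): no `_false_without_` theorem, no `-- Targets`,
no `Negative/`.  §1/§2: the witness `q` is strictly above `p_c` and `< 1` (no junk endpoint); §3: no a.s.-at-origin,
no `∀ p > p_c`, no open-edges-only reading; §7 `continuity_of_fullRecovery`: the line yields positivity at ONE `q`, not
full recovery; `continuity_of_oneArm_decay`: no one-arm bound is assumed; §8 (dimension is load-bearing): the 2-D
analogue of the ANCHOR (the LINE section of the ℤ²-quiet field percolating below `p_c(ℤ²)`) is false, so the schema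
evades `not_vacantSetPercolatesAt_two`; the LIFT is the genuinely 3-D input.
-/

namespace Summit.CriticalPhenomena.PercolationContinuityZ3.Cruxes.VacantSetPercolates.AgDimensionalLift

open MeasureTheory Set Filter
open scoped Topology
open Literature.Probability.Percolation Literature.Probability.LatticeModels

noncomputable section

/-! ### The two stubs (registered; `sorry` only here) -/

/-- **`stub_planarAnchor` — THE PLANAR ANCHOR (open; hardest).**  For some quietness scale `R ≥ 1`, at EVERY
`p < p_c(ℤ³)` the origin of the coordinate plane lies with positive probability in an infinite nearest-neighbour
component (inside the plane) of planar sites `w` whose lift `planeEmb 3 w = (w₀, w₁, 0)` is `R`-quiet —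
i.e. `σ₂(R) ≥ p_c(ℤ³)`: the planar quiet section is not planar-subcritical at `p_c(ℤ³)`.
[cite: GrimmettHolroydKozma2014, §4 (the deleted set R_n and its planar renormalisation); open for d = 3] -/
theorem stub_planarAnchor :
    ∃ R : ℕ, 1 ≤ R ∧ ∀ p : unitInterval, (p : ℝ) < criticalProb (zdGraph 3) (0 : Site 3) →
      0 < (bondPercolation (zdGraph 3) p).real
        {ω | {v : Site 2 | PathIn (zdGraph 2) {w : Site 2 | planeEmb 3 w ∈ quietSet R ω} 0 v}.Infinite} := by
  sorry

/-- **`stub_dimensionalLift` — STRICT DIMENSIONAL ENHANCEMENT `σ₃(R) > σ₂(R)` (Aizenman–Grimmett).**  For every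
`R ≥ 1` there is `δ > 0` such that whenever the planar `R`-quiet section percolates at `p`, the full 3-D `R`-quiet
field percolates (nearest-neighbour in `ℤ³`, from the origin, with positive probability) at every `q < p + δ`.
Engine: `AGLine.theta_line_mono` with the planar-sites-plus-marked-arches interpolation; the content is the local
modification `AGLine.LocMod` for this finite-range decreasing site field.
[cite: AizenmanGrimmett1991, Thm 1 (essential enhancements; p_c(ℤ³) < p_c(ℤ²))]
[cite: MartineauSevero2019, §6 (abstract line argument, tree `AGLine`)] -/
theorem stub_dimensionalLift :
    ∀ R : ℕ, 1 ≤ R → ∃ δ : ℝ, 0 < δ ∧ ∀ p q : unitInterval,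
      0 < (bondPercolation (zdGraph 3) p).real
        {ω | {v : Site 2 | PathIn (zdGraph 2) {w : Site 2 | planeEmb 3 w ∈ quietSet R ω} 0 v}.Infinite} →
      (q : ℝ) < (p : ℝ) + δ →
      0 < (bondPercolation (zdGraph 3) q).real
        {ω | {v : Site 3 | PathIn (zdGraph 3) (quietSet R ω) 0 v}.Infinite} := by
  sorry

/-! ### Glue (proved): a percolating 3-D quiet field percolates GHK's graph `X` -/

/-- On `{ω ⊆ E(ℤ³)}`, the set of sites joined to `0` by a lattice path of `R`-quiet sites is contained in the
`X`-component of `0` (`X = ℤ³[W]` keeps every lattice edge between finite-cluster sites; quiet sites have finite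
clusters). [cite: GrimmettHolroydKozma2014, §2 (definition of X) and §4] -/
theorem quietComponent_subset_X {R : ℕ} {ω : BondConfig (Site 3)} (hω : ω ⊆ (zdGraph 3).edgeSet) :
    {v : Site 3 | PathIn (zdGraph 3) (quietSet R ω) 0 v} ⊆
      openCluster {e | e ∈ (zdGraph 3).edgeSet ∧ ∀ y ∈ e, ¬ (openCluster ω y).Infinite} (0 : Site 3) := by
  intro v hv
  exact reachable_finiteClusters_of_pathIn hω hv

/-- **Lift.** Positive probability of an infinite 3-D quiet component at the origin gives positive probability of the
crux's event at the same `q` (the two differ by the null set `{ω ⊄ E(ℤ³)}`). [folklore] -/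
theorem real_vacant_pos_of_quiet_pos {R : ℕ} {q : unitInterval}
    (h : 0 < (bondPercolation (zdGraph 3) q).real
      {ω | {v : Site 3 | PathIn (zdGraph 3) (quietSet R ω) 0 v}.Infinite}) :
    0 < (bondPercolation (zdGraph 3) q).real
      {ω | (openCluster {e | e ∈ (zdGraph 3).edgeSet ∧ ∀ y ∈ e, ¬ (openCluster ω y).Infinite}
        (0 : Fin 3 → ℤ)).Infinite} := by
  set μ := bondPercolation (zdGraph 3) q with hμ
  set A : Set (BondConfig (Site 3)) :=
    {ω | {v : Site 3 | PathIn (zdGraph 3) (quietSet R ω) 0 v}.Infinite} with hA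
  set G : Set (BondConfig (Site 3)) := {ω | ω ⊆ (zdGraph 3).edgeSet} with hG
  set B : Set (BondConfig (Site 3)) :=
    {ω | (openCluster {e | e ∈ (zdGraph 3).edgeSet ∧ ∀ y ∈ e, ¬ (openCluster ω y).Infinite}
      (0 : Fin 3 → ℤ)).Infinite} with hB
  -- `A ∩ G ⊆ B`
  have hsub : A ∩ G ⊆ B := by
    rintro ω ⟨hωA, hωG⟩
    exact Set.Infinite.mono (quietComponent_subset_X hωG) hωA
  -- `G` has full measure
  have hGc : μ Gᶜ = 0 := by
    have hae : ∀ᵐ ω ∂μ, ω ⊆ (zdGraph 3).edgeSet := by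
      rw [hμ]
      exact ProbabilityTheory.setBernoulli_ae_subset
    rw [ae_iff] at hae
    exact hae
  -- hence `μ A ≤ μ (A ∩ G) ≤ μ B`
  have hApos : μ A ≠ 0 := fun h0 => h.ne' ((measureReal_eq_zero_iff (measure_ne_top _ _)).2 h0)
  have hcover : A ⊆ (A ∩ G) ∪ Gᶜ := by
    intro ω hω
    by_cases hg : ω ∈ G
    · exact Or.inl ⟨hω, hg⟩
    · exact Or.inr hg
  have hAG : μ (A ∩ G) ≠ 0 := by
    intro h0
    exact hApos (measure_mono_null hcover (measure_union_null h0 hGc))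
  have hBne : μ B ≠ 0 := fun h0 => hAG (measure_mono_null hsub h0)
  rw [measureReal_def]
  exact ENNReal.toReal_pos hBne (measure_ne_top _ _)

/-! ### Composition (glue only; concludes the crux BY NAME) -/

/-- **THE SKELETON THEOREM — the line concludes the crux BY NAME** from its two stubs: the planar anchor gives
percolation of the planar quiet section at `p = max(p_c - δ/2, 0) < p_c`; the dimensional lift pushes it to the 3-D
quiet field at `q = min(p_c + δ/4, (p_c + 1)/2) ∈ (p_c, p + δ)`; a 3-D quiet path is a path of GHK's `X`.
[cite: AizenmanGrimmett1991, Thm 1] [cite: GrimmettHolroydKozma2014, §4] -/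
theorem VacantSetPercolates_of
    (hA : ∃ R : ℕ, 1 ≤ R ∧ ∀ p : unitInterval, (p : ℝ) < criticalProb (zdGraph 3) (0 : Site 3) →
      0 < (bondPercolation (zdGraph 3) p).real
        {ω | {v : Site 2 | PathIn (zdGraph 2) {w : Site 2 | planeEmb 3 w ∈ quietSet R ω} 0 v}.Infinite})
    (hB : ∀ R : ℕ, 1 ≤ R → ∃ δ : ℝ, 0 < δ ∧ ∀ p q : unitInterval,
      0 < (bondPercolation (zdGraph 3) p).real
        {ω | {v : Site 2 | PathIn (zdGraph 2) {w : Site 2 | planeEmb 3 w ∈ quietSet R ω} 0 v}.Infinite} →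
      (q : ℝ) < (p : ℝ) + δ →
      0 < (bondPercolation (zdGraph 3) q).real
        {ω | {v : Site 3 | PathIn (zdGraph 3) (quietSet R ω) 0 v}.Infinite}) :
    Summit.CriticalPhenomena.PercolationContinuityZ3.Theses.PercBurnResprinkle.VacantSetPercolates := by
  obtain ⟨R, hR, hA⟩ := hA
  obtain ⟨δ, hδ, hB⟩ := hB R hR
  set pc : ℝ := criticalProb (zdGraph 3) (0 : Site 3) with hpc
  have hpc0 : 0 < pc := criticalProb_zd_pos 3 (by norm_num)
  have hpc1 : pc < 1 := criticalProb_zd_lt_one (by norm_num)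
  -- the anchor point `p = max(pc - δ/2, 0) < pc`
  set p' : ℝ := max (pc - δ / 2) 0 with hp'
  have hp'0 : 0 ≤ p' := le_max_right _ _
  have hp'1 : p' ≤ 1 := max_le (by linarith) zero_le_one
  have hp'lt : p' < pc := max_lt (by linarith) hpc0
  set p : unitInterval := ⟨p', hp'0, hp'1⟩ with hp
  have hAp := hA p hp'lt
  -- the witness `q = min(pc + δ/4, (pc + 1)/2)`: `pc < q < p + δ`, `q ≤ 1`
  set q' : ℝ := min (pc + δ / 4) ((pc + 1) / 2) with hq'
  have hq'gt : pc < q' := lt_min (by linarith) (by linarith)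
  have hq'0 : 0 ≤ q' := hpc0.le.trans hq'gt.le
  have hq'1 : q' ≤ 1 := (min_le_right _ _).trans (by linarith)
  have hq'lt : q' < (p : ℝ) + δ := by
    have h1 : q' ≤ pc + δ / 4 := min_le_left _ _
    have h2 : pc - δ / 2 ≤ p' := le_max_left _ _
    show q' < p' + δ
    linarith
  set q : unitInterval := ⟨q', hq'0, hq'1⟩ with hq
  have hBq := hB p q hAp hq'lt
  exact ⟨q, hq'gt, real_vacant_pos_of_quiet_pos hBq⟩

/-- The line applied to its stubs: the crux, by name. -/
theorem VacantSetPercolates_holds_of_stubs :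
    Summit.CriticalPhenomena.PercolationContinuityZ3.Theses.PercBurnResprinkle.VacantSetPercolates :=
  VacantSetPercolates_of stub_planarAnchor stub_dimensionalLift

end

end Summit.CriticalPhenomena.PercolationContinuityZ3.Cruxes.VacantSetPercolates.AgDimensionalLift
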